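import Mathlib
import Summits.Ventures.HodgeRepro.CMHodgeWedge

/-!
# Hodge structures of CM type: the `(p, p)`-classes of `⋀^{2p} ℂ^{Hom(K, ℂ)}` are spanned by Pohlmann's wedges

Blind re-derivation cell `pub-hodge-repro`, seat `typer-2`.  Built on `CMHodgeWedge.lean` (the action of the
conjugate cocharacters `μ_{gΦ}(λ)` on coordinate wedges).

Printed source: Deligne, LNM 900, Example 3.7 (scan p. 41) and §3; Pohlmann's census as printed in Gordon
§9.2 (9.2.1).  The Mumford–Tate torus of an abelian variety of CM type `(K, Φ)` is generated by the Galois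
conjugates `μ_{gΦ}`, `g ∈ Gal(K/ℚ)`, of the Hodge cocharacter, and the Hodge classes of `⋀^{2p} H¹` are the
classes on which it acts through the weight — on `⋀^{2p} ℂ^{Hom(K, ℂ)}`, the classes `ω` with
`⋀^{2p} μ_{gΦ}(λ) ω = λ^p ω` for every `g` and `λ`.  Since every `⋀^{2p} μ_{gΦ}(λ)` is DIAGONAL in the basis
of coordinate wedges (`CMHodgeWedge.map_cochar_coordWedge`), that joint eigenspace is spanned by the
coordinate wedges it contains, i.e. by the `e_Δ` with `|Δ ∩ gΦ| = p` for all `g` — Pohlmann's census.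

This file:

* `mem_span_image_of_forall_eq` — linear algebra: a joint eigenvector of a family of operators that are
  diagonal in a basis lies in the span of the basis vectors with the same eigenvalues;
* `coordBasis K` — the coordinate basis of `ℂ^{Hom(K, ℂ)}` indexed by `Fin [K : ℚ]` (`embIndexEquiv`), and
  `coordBasis_exteriorPower_apply` — its exterior-power basis (Mathlib `Module.Basis.exteriorPower`) consists
  of the coordinate wedges `coordWedge n (enumOf n S)` of injective enumerations;
* `jointEigenspace φ₀ Φ n p` — the classes of `⋀^n ℂ^{Hom(K, ℂ)}` on which every conjugate cocharacter
  `μ_{gΦ}(λ)` acts by `λ^p`, and `pohlmannWedges φ₀ c Φ p` — the coordinate wedges `e_Δ`, `|Δ| = 2p`, whose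
  corner set satisfies typer's `IsHodgeSet` (Pohlmann's (9.2.1)) in the group model;
* **`jointEigenspace_eq_span`**: `jointEigenspace φ₀ Φ (2p) p = span ℂ (pohlmannWedges φ₀ c Φ p)` — on a
  Galois CM field (group-model hypotheses `hc : IsComplexConj c`, `hΦ : IsCMType c Φ'`), the
  `(p, p)`-classes for all Galois conjugates of the Hodge structure are exactly the span of Pohlmann's wedges.

What is NOT typed (printed, Deligne §3): that the Hodge classes of the abelian variety are the classes fixed
by the Mumford–Tate group and that `MT(A)` is generated by the conjugate cocharacters.
-/

open Module Finset
open scoped Pointwise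

namespace HodgeRepro.CMHodge

section Abstract

variable {𝕜 W ι J : Type*} [Field 𝕜] [AddCommGroup W] [Module 𝕜 W]

/-- **Joint eigenvectors of operators diagonal in a basis.**  If every `T j` acts on the basis vector `b i`
by the scalar `c j i`, then a vector `w` with `T j w = d j • w` for all `j` lies in the span of the basis
vectors `b i` with `c j i = d j` for all `j`. -/
theorem mem_span_image_of_forall_eq (b : Basis ι 𝕜 W) (T : J → W →ₗ[𝕜] W) (c : J → ι → 𝕜)
    (hT : ∀ j i, T j (b i) = c j i • b i) (d : J → 𝕜) {w : W} (hw : ∀ j, T j w = d j • w) :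
    w ∈ Submodule.span 𝕜 (b '' {i | ∀ j, c j i = d j}) := by
  rw [Module.Basis.mem_span_image]
  intro i hi
  rw [Finset.mem_coe, Finsupp.mem_support_iff] at hi
  intro j
  by_contra hne
  apply hi
  have key : (b.coord i).comp (T j) = c j i • b.coord i := b.ext fun i' => by
    simp only [LinearMap.comp_apply, hT, map_smul, LinearMap.smul_apply, Module.Basis.coord_apply,
      Module.Basis.repr_self, smul_eq_mul]
    by_cases h : i' = i
    · subst h
      simp
    · simp [h]
  have h1 := LinearMap.congr_fun key w
  simp only [LinearMap.comp_apply, LinearMap.smul_apply, Module.Basis.coord_apply, smul_eq_mul] at h1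
  rw [hw j, map_smul, Finsupp.smul_apply, smul_eq_mul] at h1
  have h2 : (c j i - d j) * b.repr w i = 0 := by rw [sub_mul, h1, sub_self]
  rcases mul_eq_zero.1 h2 with h | h
  · exact absurd (sub_eq_zero.1 h) hne
  · exact h

end Abstract

variable {K : Type*} [Field K] [NumberField K]

section CoordBasis

open scoped Classical

variable (K) in
/-- The coordinate basis of `ℂ^{Hom(K, ℂ)}`, indexed by `Fin [K : ℚ]` through `embIndexEquiv K`. -/
noncomputable def coordBasis : Basis (Fin (finrank ℚ K)) ℂ ((K →ₐ[ℚ] ℂ) → ℂ) :=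
  (Pi.basisFun ℂ (K →ₐ[ℚ] ℂ)).reindex (embIndexEquiv K).symm

/-- `coordBasis K i = e_{embIndexEquiv K i}`. -/
theorem coordBasis_apply (i : Fin (finrank ℚ K)) : coordBasis K i = coordVec (embIndexEquiv K i) := by
  simp [coordBasis, Module.Basis.reindex_apply, Pi.basisFun_apply, coordVec]

/-- The injective enumeration `i ↦ embIndexEquiv K (S_i)` of an `n`-element set `S` of basis indices
(`S_0 < S_1 < ⋯`), i.e. of a set of `n` embeddings. -/
noncomputable def enumOf (n : ℕ) (S : Set.powersetCard (Fin (finrank ℚ K)) n) : Fin n → (K →ₐ[ℚ] ℂ) :=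
  fun i => embIndexEquiv K (Set.powersetCard.ofFinEmbEquiv.symm S i)

/-- `enumOf n S` is injective. -/
theorem enumOf_injective (n : ℕ) (S : Set.powersetCard (Fin (finrank ℚ K)) n) :
    Function.Injective (enumOf n S) :=
  (embIndexEquiv K).injective.comp (Set.powersetCard.ofFinEmbEquiv.symm S).injective

/-- **The basis of `⋀^n ℂ^{Hom(K, ℂ)}` by coordinate wedges**: the exterior-power basis of `coordBasis K`
(Mathlib's `Module.Basis.exteriorPower`) at the `n`-set `S` is the coordinate wedge of the enumeration of
`S`. -/
theorem coordBasis_exteriorPower_apply (n : ℕ) (S : Set.powersetCard (Fin (finrank ℚ K)) n) :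
    (coordBasis K).exteriorPower n S = coordWedge n (enumOf n S) := by
  rw [exteriorPower.basis_apply]
  unfold exteriorPower.ιMulti_family coordWedge
  congr 1
  funext i
  exact coordBasis_apply _

end CoordBasis

section Galois

variable [IsGalois ℚ K] (φ₀ : K →+* ℂ)

open scoped Classical

/-- The classes of `⋀^n ℂ^{Hom(K, ℂ)}` on which every conjugate cocharacter `μ_{gΦ}(λ)`, `g ∈ Gal(K/ℚ)`,
acts by `λ^p` — for `n = 2p`, the `(p, p)`-classes of every Galois conjugate of the Hodge structure of
type `Φ`. -/
noncomputable def jointEigenspace (Φ : Set (K →ₐ[ℚ] ℂ)) (n p : ℕ) :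
    Submodule ℂ (⋀[ℂ]^n ((K →ₐ[ℚ] ℂ) → ℂ)) :=
  ⨅ (g : K ≃ₐ[ℚ] K) (lam : ℂ),
    LinearMap.ker (exteriorPower.map n (cochar (smulSet φ₀ g Φ) lam) - lam ^ p • LinearMap.id)

/-- Membership in `jointEigenspace`. -/
theorem mem_jointEigenspace_iff (Φ : Set (K →ₐ[ℚ] ℂ)) (n p : ℕ) (ω : ⋀[ℂ]^n ((K →ₐ[ℚ] ℂ) → ℂ)) :
    ω ∈ jointEigenspace φ₀ Φ n p ↔
      ∀ (g : K ≃ₐ[ℚ] K) (lam : ℂ),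
        exteriorPower.map n (cochar (smulSet φ₀ g Φ) lam) ω = lam ^ p • ω := by
  simp only [jointEigenspace, Submodule.mem_iInf, LinearMap.mem_ker, LinearMap.sub_apply,
    LinearMap.smul_apply, LinearMap.id_apply, sub_eq_zero]

/-- **Pohlmann's wedges**: the coordinate wedges `e_Δ = e_{s 0} ∧ ⋯ ∧ e_{s (2p−1)}` of injective families
`s` of `2p` embeddings whose corner set satisfies Pohlmann's condition `IsHodgeSet c Φ' Δ'` (typer's
(9.2.1)) in the group model. -/
def pohlmannWedges (c : K ≃ₐ[ℚ] K) (Φ : Set (K →ₐ[ℚ] ℂ)) (p : ℕ) :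
    Set (⋀[ℂ]^(2 * p) ((K →ₐ[ℚ] ℂ) → ℂ)) :=
  {ω | ∃ s : Fin (2 * p) → (K →ₐ[ℚ] ℂ), Function.Injective s ∧
    IsHodgeSet c (toGalSet φ₀ Φ).toFinset (toGalSet φ₀ (Set.range s)).toFinset ∧ coordWedge (2 * p) s = ω}

/-- Every Pohlmann wedge is a `(p, p)`-class for every conjugate cocharacter. -/
theorem span_pohlmannWedges_le {c : K ≃ₐ[ℚ] K} (hc : IsComplexConj c) (Φ : Set (K →ₐ[ℚ] ℂ))
    (hΦ : IsCMType c (toGalSet φ₀ Φ).toFinset) (p : ℕ) :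
    Submodule.span ℂ (pohlmannWedges φ₀ c Φ p) ≤ jointEigenspace φ₀ Φ (2 * p) p := by
  rw [Submodule.span_le]
  rintro ω ⟨s, hs, hS, rfl⟩
  rw [SetLike.mem_coe, mem_jointEigenspace_iff]
  exact (isHodgeSet_iff_forall_map_cochar_smulSet_eq φ₀ hc Φ hΦ hs).1 hS

/-- Every `(p, p)`-class for all conjugate cocharacters is a combination of Pohlmann wedges (the conjugate
cocharacters are diagonal in the basis of coordinate wedges; evaluate at `λ = 2`). -/
theorem jointEigenspace_le_span {c : K ≃ₐ[ℚ] K} (hc : IsComplexConj c) (Φ : Set (K →ₐ[ℚ] ℂ))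
    (hΦ : IsCMType c (toGalSet φ₀ Φ).toFinset) (p : ℕ) :
    jointEigenspace φ₀ Φ (2 * p) p ≤ Submodule.span ℂ (pohlmannWedges φ₀ c Φ p) := by
  intro ω hω
  rw [mem_jointEigenspace_iff] at hω
  have h := mem_span_image_of_forall_eq ((coordBasis K).exteriorPower (2 * p))
    (fun gl : (K ≃ₐ[ℚ] K) × ℂ => exteriorPower.map (2 * p) (cochar (smulSet φ₀ gl.1 Φ) gl.2))
    (fun gl S => gl.2 ^ cornerCount (smulSet φ₀ gl.1 Φ) (enumOf (2 * p) S))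
    (fun gl S => by rw [coordBasis_exteriorPower_apply]; exact map_cochar_coordWedge _ _ _)
    (fun gl => gl.2 ^ p) (fun gl => hω gl.1 gl.2)
  refine Submodule.span_mono ?_ h
  rintro _ ⟨S, hS, rfl⟩
  refine ⟨enumOf (2 * p) S, enumOf_injective _ _, ?_, (coordBasis_exteriorPower_apply _ _).symm⟩
  rw [isHodgeSet_iff_forall_card_eq hc hΦ _ p (card_toGalSet_range φ₀ (2 * p) (enumOf_injective _ _))]
  intro g
  have h2 : (2 : ℂ) ^ cornerCount (smulSet φ₀ g Φ) (enumOf (2 * p) S) = 2 ^ p := hS (g, 2)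
  rw [← cornerCount_smulSet_eq_card φ₀ Φ g (enumOf_injective _ _)]
  have h' : ((2 ^ cornerCount (smulSet φ₀ g Φ) (enumOf (2 * p) S) : ℕ) : ℂ) = ((2 ^ p : ℕ) : ℂ) := by
    push_cast
    exact h2
  exact Nat.pow_right_injective (le_refl 2) (Nat.cast_injective h')

/-- **Pohlmann's census on the kernel**: on a Galois CM field (group-model hypotheses `hc`, `hΦ`), the
classes of `⋀^{2p} ℂ^{Hom(K, ℂ)}` on which every Galois conjugate `μ_{gΦ}(λ)` of the Hodge cocharacter acts
by `λ^p` — the `(p, p)`-classes of all conjugate Hodge structures — are exactly the span of the coordinate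
wedges `e_Δ` with `|Δ ∩ gΦ| = p` for all `g` (`IsHodgeSet`, Pohlmann's (9.2.1)). -/
theorem jointEigenspace_eq_span {c : K ≃ₐ[ℚ] K} (hc : IsComplexConj c) (Φ : Set (K →ₐ[ℚ] ℂ))
    (hΦ : IsCMType c (toGalSet φ₀ Φ).toFinset) (p : ℕ) :
    jointEigenspace φ₀ Φ (2 * p) p = Submodule.span ℂ (pohlmannWedges φ₀ c Φ p) :=
  le_antisymm (jointEigenspace_le_span φ₀ hc Φ hΦ p) (span_pohlmannWedges_le φ₀ hc Φ hΦ p)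

end Galois

end HodgeRepro.CMHodge
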